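import Summits.HodgeConjecture.CorCM.MultiFieldWeilTwinUnitsMany
import Summits.HodgeConjecture.CorCM.MultiFieldWeilSlotwiseSeparation
import HarnessLib

/-!
# MULTI-FIELD WEIL ENGINE — TWIN UNITS WITH THE SLOT MENU: the defect law for tuple sets with any number of twin pairs of slots and, on the single slots, Z1's menu
# (prime size ∕ one-member position set ∕ homogeneous image) instead of primality (census level)

Cell `pub-hodgecm2` (COR-CM), seat b30 gen 38 (2026-08-25); count-neutral own lane MULTI-FIELD WEIL ENGINE (stem `MultiFieldWeil*`), census level, the join of gen 37's
`CorCM/MultiFieldWeilTwinUnitsMany.lean` (T1b: several twin pairs, single slots PRIME, peeled by V1's prime tower) and `CorCM/MultiFieldWeilSlotwiseSeparation.lean` (Z1: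
in the product of the slot images every slot is moved ALONE, so a separating image suffices — `sum_preG_eq_of_signed_update`, `sep_of_kind`).  Theorems only; no definition,
no named fact, no `sorry`, no `decide`.  HONEST FRAMING: pure finite combinatorics; `HC_CM` is NOT touched.

**`exists_hasDefectsG_of_twinsStabiliserTransitive_kind`** — the twin pairs are the fibres of an involution `tw` (diagonal, `2`-transitive, one size `≥ 3`, singleton position
sets `{q_m} ≠ {q_{tw m}}`); `R` non-empty, closed, transitive on every slot, STABILISER-TRANSITIVE ACROSS UNITS; every SINGLE slot of prime size with a proper non-empty position
set, OR with a one-member position set (e.g. `(1,3)`-octics), OR with a homogeneous image (e.g. `(2,2)`-octics with `2`-transitive quartic part).  Then every configuration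
balanced under `R` obeys the defect law.  PROOF = T1b's verbatim, except that the single slots are no longer peeled by the prime tower: in the unit-wise product `R⁺` the tuple
`(1, …, π_{m₀}, …, 1)` lies in `R⁺` for every `π ∈ R` and every single slot `m₀`, so the position-set sums of the defect `d_{m₀}` agree through all translates (Z1 §1) and the
menu separates (Z1 §3).  This is the census core for «SEVERAL DOUBLED SEXTIC FIELDS over `k` TOGETHER WITH OCTIC AND DECIC SLOTS» — the realised reading and the
geometric dress (gen 37's T2b ∕ T3b ∕ T5b with Z3's nine-case `hST` supplier) are the successor's items.

[cite: MoonenZarhin1995Duke, Thm. 2.4] [cite: Pohlmann1968, Thm 1] [cite: GaoUllmo2025, Thm 3.1] [cite: DixonMortimer1996, §1.6 and Thm. 1.6A; §2.1]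

## References
* [MoonenZarhin1995Duke] B. Moonen, Yu. Zarhin, Duke Math. J. 77 (1995), Thm. 2.4.  [Pohlmann1968] H. Pohlmann, Ann. of Math. 88 (1968), Thm 1.  [GaoUllmo2025] Z. Gao, E. Ullmo,
  J. Inst. Math. Jussieu 25 (2025), Thm 3.1.  [DixonMortimer1996] J. D. Dixon, B. Mortimer, *Permutation Groups*, GTM 163, §1.6 (Thm. 1.6A), §2.1.
-/

noncomputable section

namespace Summit.HodgeConjecture.CorCM.MultiFieldWeil

open Finset
open Summit.HodgeConjecture.CorCM.Census.MultiFieldWeil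

open scoped Classical

section Model

variable {r : ℕ} {n : Fin r → ℕ} {R : Finset (PermsG n)} {P : ∀ m : Fin r, Finset (Fin (n m))}

/-- **THE DEFECT LAW WITH SEVERAL TWIN PAIRS AND THE SLOT MENU ON THE SINGLE SLOTS.**  As T1b `exists_hasDefectsG_of_twinsStabiliserTransitive`, with «all slots of PRIME size
with proper non-empty position sets» replaced, on the SINGLE slots (`tw m = m`), by Z1's menu: prime size with a proper non-empty position set, OR a one-member position set,
OR a homogeneous image; the twin slots (one size `≥ 3`, singleton position sets, diagonal `2`-transitive tuples) are untouched.  See the module docstring.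
[cite: MoonenZarhin1995Duke, Thm. 2.4] [cite: DixonMortimer1996, §1.6 and Thm. 1.6A; §2.1] [cite: GaoUllmo2025, Thm 3.1] -/
theorem exists_hasDefectsG_of_twinsStabiliserTransitive_kind (hmul : ∀ π ∈ R, ∀ π' ∈ R, π * π' ∈ R) (hinv : ∀ π ∈ R, π⁻¹ ∈ R) (hne : R.Nonempty)
    (htrans : ∀ (m : Fin r) (a a' : Fin (n m)), ∃ π ∈ R, π m a = a')
    (tw : Fin r → Fin r) (htw : ∀ m, tw (tw m) = m) (hn : ∀ m, n (tw m) = n m) (h3 : ∀ m, tw m ≠ m → 3 ≤ n m)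
    (hdiag : ∀ π ∈ R, ∀ m, tw m ≠ m → ∀ a : Fin (n (tw m)), Fin.cast (hn m) (π (tw m) a) = π m (Fin.cast (hn m) a))
    (h2t : ∀ m, tw m ≠ m → ∀ a a' b b' : Fin (n m), a ≠ a' → b ≠ b' → ∃ π ∈ R, π m a = b ∧ π m a' = b')
    (hstab : ∀ (m₀ m : Fin r), m₀ ≠ m → tw m₀ ≠ m → ∀ a a' : Fin (n m), ∃ ν ∈ R, ν m₀ = 1 ∧ ν (tw m₀) = 1 ∧ ν m a = a')
    (hkind : ∀ m, tw m = m → ((n m).Prime ∧ (P m).Nonempty ∧ (P m).card < n m) ∨ (P m).card = 1 ∨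
      ((0 < (P m).card ∧ (P m).card < n m) ∧ ∀ Q : Finset (Fin (n m)), Q.card = (P m).card → ∃ π ∈ R, preG (π m) (P m) = Q))
    (q : ∀ m : Fin r, Fin (n m)) (hPq : ∀ m, tw m ≠ m → P m = {q m}) (hq : ∀ m, tw m ≠ m → Fin.cast (hn m) (q (tw m)) ≠ q m)
    (c : Fin r → ℕ) (hc : ∀ m, ((c m : ℕ) : ℤ) = (n m : ℤ) - 2 * (P m).card)
    {α : Type} (v : α → PtG n) (T : Finset α) (hT : ModelBalancedG P R v T) : ∃ t : Fin r → ℤ, HasDefectsG c v T t := by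
  have h1R : (1 : PermsG n) ∈ R := one_mem_of_closed hmul hinv hne
  -- the units: `U m = U m' ↔ m' ∈ {m, tw m}`
  let U : Fin r → Fin r := fun m => if (tw m : ℕ) < (m : ℕ) then tw m else m
  have hUtw : ∀ m, U (tw m) = U m := by
    intro m
    simp only [U, htw]
    by_cases h : (tw m : ℕ) < (m : ℕ)
    · rw [if_pos h, if_neg (lt_asymm h)]
    · rw [if_neg h]
      by_cases h' : (m : ℕ) < (tw m : ℕ)
      · rw [if_pos h']
      · have : (tw m : ℕ) = m := by omega
        rw [if_neg (by omega)]; exact Fin.ext this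
  have hUmem : ∀ m, U m = m ∨ U m = tw m := fun m => by
    simp only [U]; split_ifs
    · exact Or.inr rfl
    · exact Or.inl rfl
  have hUfib : ∀ m m', U m' = U m ↔ m' = m ∨ m' = tw m := by
    intro m m'
    constructor
    · intro h
      rcases hUmem m' with h₁ | h₁ <;> rcases hUmem m with h₂ | h₂
      · exact Or.inl (h₁.symm.trans (h.trans h₂))
      · exact Or.inr (h₁.symm.trans (h.trans h₂))
      · right; have := h₁.symm.trans (h.trans h₂); rw [← this, htw]  -- tw m' = m → m' = tw m
      · left; have := h₁.symm.trans (h.trans h₂)  -- tw m' = tw m → m' = m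
        rw [← htw m', this, htw]
    · rintro (rfl | rfl)
      · rfl
      · exact hUtw m
  -- the unit-wise product `R'`
  set R' : Finset (PermsG n) := Finset.univ.filter fun π' => ∀ m₀, ∃ π ∈ R, ∀ m, U m = U m₀ → π m = π' m with hR'
  have hmemR' : ∀ π' : PermsG n, π' ∈ R' ↔ ∀ m₀, ∃ π ∈ R, ∀ m, U m = U m₀ → π m = π' m := fun π' => by simp [hR']
  have hRR' : R ⊆ R' := fun π hπ => (hmemR' π).2 fun m₀ => ⟨π, hπ, fun _ _ => rfl⟩
  have hmul' : ∀ π ∈ R', ∀ π' ∈ R', π * π' ∈ R' := by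
    intro π₁ h₁ π₂ h₂
    rw [hmemR'] at h₁ h₂ ⊢
    intro m₀
    obtain ⟨ρ₁, hρ₁, e₁⟩ := h₁ m₀
    obtain ⟨ρ₂, hρ₂, e₂⟩ := h₂ m₀
    exact ⟨ρ₁ * ρ₂, hmul _ hρ₁ _ hρ₂, fun m hm => by rw [Pi.mul_apply, Pi.mul_apply, e₁ m hm, e₂ m hm]⟩
  have hinv' : ∀ π ∈ R', π⁻¹ ∈ R' := by
    intro π₁ h₁
    rw [hmemR'] at h₁ ⊢
    intro m₀
    obtain ⟨ρ, hρ, e⟩ := h₁ m₀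
    exact ⟨ρ⁻¹, hinv _ hρ, fun m hm => by rw [Pi.inv_apply, Pi.inv_apply, e m hm]⟩
  have hne' : R'.Nonempty := hne.mono hRR'
  have htrans' : ∀ (m : Fin r) (a a' : Fin (n m)), ∃ π ∈ R', π m a = a' := fun m a a' => by
    obtain ⟨π, hπ, h⟩ := htrans m a a'
    exact ⟨π, hRR' hπ, h⟩
  -- hybrids: a tuple of `R` on the unit of `m`, another tuple of `R'` elsewhere, lies in `R'`
  have hhyb : ∀ (m : Fin r) (π : PermsG n), π ∈ R → ∀ π₀ ∈ R', (fun m' => if U m' = U m then π m' else π₀ m') ∈ R' := by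
    intro m π hπ π₀ hπ₀
    rw [hmemR'] at hπ₀ ⊢
    intro m₀
    by_cases hm₀ : U m₀ = U m
    · refine ⟨π, hπ, fun m' hm' => ?_⟩
      simp only [hm'.trans hm₀, if_true]
    · obtain ⟨ρ, hρ, e⟩ := hπ₀ m₀
      refine ⟨ρ, hρ, fun m' hm' => ?_⟩
      have : U m' ≠ U m := fun h => hm₀ (hm'.symm.trans h)
      simp only [this, if_false, e m' hm']
  -- the defects and the signed equations at `R`, transferred to `R'`
  set d : ∀ m : Fin r, Fin (n m) → ℤ := fun m a => ((cnt v T (Sum.inr ⟨m, (a, true)⟩)) : ℤ) - cnt v T (Sum.inr ⟨m, (a, false)⟩) with hd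
  have hsig : ∀ π ∈ R', (((cnt v T (Sum.inl true)) : ℤ) - cnt v T (Sum.inl false)) +
      ∑ m : Fin r, ∑ a : Fin (n m), (if π m a ∈ P m then d m a else -d m a) = 0 := fun π' hπ' =>
    signed_transfer_units (d := d) U hmul hne htrans (fun m₀ m hmm a a' => by
        have h₁ : m₀ ≠ m := fun h => hmm (by rw [h])
        have h₂ : tw m₀ ≠ m := fun h => hmm (by rw [← h, hUtw])
        obtain ⟨ν, hν, hν₀, hν₁, hνa⟩ := hstab m₀ m h₁ h₂ a a'
        refine ⟨ν, hν, fun m' hm' => ?_, hνa⟩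
        rcases (hUfib m₀ m').1 hm' with rfl | rfl
        exacts [hν₀, hν₁])
      (fun π hπ => signed_of_modelBalancedG R v hT hπ) π' ((hmemR' π').1 hπ')
  -- every SINGLE slot is moved ALONE inside `R'`: its defect is constant by slot-wise separation (Z1 `sum_preG_eq_of_signed_update`, `sep_of_kind`)
  have h1R' : (1 : PermsG n) ∈ R' := hRR' h1R
  have hupd : ∀ m₀, tw m₀ = m₀ → ∀ π₁ ∈ R, Function.update (1 : PermsG n) m₀ (π₁ m₀) ∈ R' := by
    intro m₀ htw₀ π₁ hπ₁
    refine (hmemR' _).2 fun m' => ?_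
    by_cases hm' : U m' = U m₀
    · refine ⟨π₁, hπ₁, fun m hmm => ?_⟩
      have hmm' : m = m₀ := by
        rcases (hUfib m₀ m).1 (hmm.trans hm') with h | h
        · exact h
        · rw [h, htw₀]
      subst hmm'
      rw [Function.update_self]
    · refine ⟨1, h1R, fun m hmm => ?_⟩
      have hmm' : m ≠ m₀ := fun h => hm' (by rw [← h, hmm])
      rw [Function.update_of_ne hmm', Pi.one_apply]
  have hconst : ∀ m₀, tw m₀ = m₀ → ∀ a b : Fin (n m₀), d m₀ a = d m₀ b := fun m₀ htw₀ =>
    sep_of_kind hmul hinv hne (htrans m₀) (hkind m₀ htw₀) (d m₀) fun π hπ => sum_preG_eq_of_signed_update (d := d) h1R' (hupd m₀ htw₀ π hπ) hsig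
  -- the twin units, one at a time: vary the unit of `m` against a base tuple `π₀`
  obtain ⟨π₀, hπ₀⟩ := hne'
  have htwins : ∀ m, tw m ≠ m → ∀ a b : Fin (n m), d m a = d m b := by
    intro m htm
    let D : Finset (PermsG n) := R'.filter fun π => ∀ m', U m' ≠ U m → π m' = π₀ m'
    have hD : ∀ π, π ∈ D ↔ π ∈ R' ∧ ∀ m', U m' ≠ U m → π m' = π₀ m' := fun π => Finset.mem_filter
    -- the signed equation on `D`: the other units are frozen
    set w : ℤ := -((((cnt v T (Sum.inl true)) : ℤ) - cnt v T (Sum.inl false)) +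
      ∑ m' ∈ (Finset.univ.erase m).erase (tw m), ∑ a : Fin (n m'), (if π₀ m' a ∈ P m' then d m' a else -d m' a)) with hw
    have hmt : tw m ∈ Finset.univ.erase m := Finset.mem_erase.2 ⟨htm, Finset.mem_univ _⟩
    have heqD : ∀ π ∈ D, (∑ a : Fin (n m), (if π m a ∈ P m then d m a else -d m a)) +
        (∑ a : Fin (n (tw m)), (if π (tw m) a ∈ P (tw m) then d (tw m) a else -d (tw m) a)) = w := by
      intro π hπ
      obtain ⟨hπR', hπfix⟩ := (hD π).1 hπ
      have hs := hsig π hπR'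
      rw [← Finset.add_sum_erase _ _ (Finset.mem_univ m), ← Finset.add_sum_erase _ _ hmt] at hs
      have hrest : (∑ m' ∈ (Finset.univ.erase m).erase (tw m), ∑ a : Fin (n m'), (if π m' a ∈ P m' then d m' a else -d m' a)) =
          ∑ m' ∈ (Finset.univ.erase m).erase (tw m), ∑ a : Fin (n m'), (if π₀ m' a ∈ P m' then d m' a else -d m' a) :=
        Finset.sum_congr rfl fun m' hm' => by
          have h₁ : m' ≠ tw m := Finset.ne_of_mem_erase hm'
          have h₂ : m' ≠ m := Finset.ne_of_mem_erase (Finset.mem_of_mem_erase hm')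
          rw [hπfix m' (fun h => by rcases (hUfib m m').1 h with h' | h' <;> [exact h₂ h'; exact h₁ h'])]
      rw [hrest] at hs
      simp only [hw]
      linarith
    have htwin := const_of_signed_twin (P := P) (D := D) (m₁ := m) (m₂ := tw m) (hn m) (h3 m htm) (hPq m htm) (hPq (tw m) (by rw [htw]; exact Ne.symm htm))
      (hq m htm)
      (fun π hπ a => by
        obtain ⟨hπR', -⟩ := (hD π).1 hπ
        obtain ⟨ρ, hρ, hρe⟩ := (hmemR' π).1 hπR' m
        rw [← hρe m rfl, ← hρe (tw m) (hUtw m)]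
        exact hdiag ρ hρ m htm a)
      (fun a a' b b' haa hbb => by
        obtain ⟨π, hπ, hb, hb'⟩ := h2t m htm a a' b b' haa hbb
        refine ⟨fun m' => if U m' = U m then π m' else π₀ m', (hD _).2 ⟨hhyb m π hπ π₀ hπ₀, fun m' hm' => by simp only [hm', if_false]⟩, ?_, ?_⟩
        · show (if U m = U m then π m else π₀ m) a = b
          rw [if_pos rfl]; exact hb
        · show (if U m = U m then π m else π₀ m) a' = b'
          rw [if_pos rfl]; exact hb')
      (d := d) (w := w) heqD
    exact htwin.1
  -- all defects are constant
  have hall : ∀ (m : Fin r) (a b : Fin (n m)), d m a = d m b := by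
    intro m
    by_cases htm : tw m = m
    · exact hconst m htm
    · exact htwins m htm
  obtain ⟨t, hdt, he⟩ := exists_defects_of_const (P := P) ⟨π₀, hπ₀⟩ hall hsig
  refine ⟨t, fun m a => hdt m a, ?_⟩
  rw [he]
  exact Finset.sum_congr rfl fun m _ => by rw [hc m]

end Model

end Summit.HodgeConjecture.CorCM.MultiFieldWeil

end
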